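import Summits.Ventures.CertifiedArithmetic.LowPrec.GemmGridRoundingWide

/-!
# The `bfloat16` bridge on dyadic grids below `2^120` grid units (for the `E5M2` alphabets)

HONEST FRAMING (venture CertifiedArithmetic / cell `pub-lowprec`, seat gemm, gen 8): certified error
envelopes and provably optimal rounding/accumulation schemes for low-precision formats under stated
cost models; every table by two implementations; no hardware or vendor claims.

`GemmGridRoundingWide.lean` proved `fl_bf16(K/2^g) = rne8 K / 2^g` for `g ≤ 133`, `|K| < 2^64` — enough
for the E4M3·E4M3 alphabet of `gemm.tex` §Regimes (grid `2^-18`, states up to `2^44` grid units).  The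
remaining FP8 rows of Prop. Θ live on finer grids with larger state ranges: E5M2·E5M2 products are
integers on the grid `2^-32` and the accumulator moves until every letter is absorbed, i.e. up to about
`2^41`, which is `2^73` grid units; the mixed alphabet E4M3·E5M2 (grid `2^-25`, states up to `2^33`)
needs `2^58`.  The proof of the bridge uses the bound on `|K|` only to stay below `maxRat(bfloat16) =
(2^8 - 1)·2^120`, so it holds verbatim below `2^120` grid units: `toRat_roundNE_BFloat16_rne8_wide`, with
the step/gain/deficit dictionary `flStep_dyadic120`, `gainOf_dyadic120`, `deficitOf_dyadic120`, the
monotonicity `rne8_mono120`, and the product grids of the two alphabets (`toRat_mul_toRat_E5M2`: grid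
`2^-32`; `toRat_mul_toRat_E4M3_E5M2`: grid `2^-25`).  Infrastructure for the next θ-certificates
(cell HANDOFF X1); nothing here is specific to gemm.
-/

namespace Literature.ComputerArithmetic.FloatingPoint

namespace MiniFloat

open Format

/-- THE BRIDGE on the grid `2^-g`, `g ≤ 133`, below `2^120` grid units:
`fl_bf16(K / 2^g) = rne8 K / 2^g`. [folklore; closed form `Format.rneGrid_of_pattern`] -/
theorem toRat_roundNE_BFloat16_rne8_wide {g : ℕ} (hg : g ≤ 133) (K : ℤ) (hK : K.natAbs < 2 ^ 120) :
    (roundNE Format.BFloat16 ((K : ℚ) / 2 ^ g)).toRat = (rne8 K : ℚ) / 2 ^ g := by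
  have h2g : (0 : ℚ) < 2 ^ g := by positivity
  have habs : |(K : ℚ) / 2 ^ g| = (K.natAbs : ℚ) / 2 ^ g := by
    rw [abs_div, abs_of_pos h2g, Nat.cast_natAbs, Int.cast_abs]
  have hsgn : (K : ℚ) / 2 ^ g < 0 ↔ K < 0 := by
    rw [div_lt_iff₀ h2g, zero_mul]; norm_cast
  by_cases hn : K.natAbs < 256
  · exact toRat_roundNE_BFloat16_rne8 hg K (lt_trans hn (by norm_num))
  · set k := Nat.log2 K.natAbs - 7 with hk
    set d := 133 - g with hd
    obtain ⟨hlo, hhi⟩ := log2_binade (not_lt.mp hn)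
    have hq2 : Format.BFloat16.quantum = 1 / 2 ^ 133 := BFloat16_maxRat.2
    have h133 : (2 : ℚ) ^ 133 = 2 ^ d * 2 ^ g := by rw [← pow_add, hd, Nat.sub_add_cancel hg]
    have hx : |(K : ℚ) / 2 ^ g|
        = (K.natAbs : ℚ) * 2 ^ (d + k) / 2 ^ k * Format.BFloat16.quantum := by
      rw [habs, hq2, h133, pow_add]; field_simp
    have hmax : |(K : ℚ) / 2 ^ g| ≤ Format.BFloat16.maxRat := by
      rw [habs, BFloat16_maxRat.1]
      have hlt : ((K.natAbs : ℕ) : ℚ) < 2 ^ 120 := by exact_mod_cast hK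
      have h1 : (1 : ℚ) ≤ 2 ^ g := one_le_pow₀ (by norm_num)
      calc ((K.natAbs : ℕ) : ℚ) / 2 ^ g ≤ (K.natAbs : ℕ) := div_le_self (by positivity) h1
        _ ≤ (2 ^ 8 - 1) * 2 ^ 120 := by norm_num at hlt ⊢; linarith
    have hlo' : 2 ^ (Format.BFloat16.manBits + k) ≤ K.natAbs := by rw [BFloat16_manBits]; exact hlo
    have hhi' : K.natAbs < 2 ^ (Format.BFloat16.manBits + k + 1) := by
      rw [BFloat16_manBits]; exact hhi
    have hgrid := Format.rneGrid_of_pattern hlo' hhi' (pattern_le_maxScaled hx hmax)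
    rw [rneInt_natCast_div_two_pow, Int.cast_natCast] at hgrid
    rw [toRat_roundNE, scaledInput_of_pattern hx]
    unfold rne8 rne8Mag
    rw [if_neg hn, ← hk]
    simp only [hsgn]
    split_ifs with hneg
    · rw [neg_mul, hgrid, hq2, h133]; push_cast; rw [pow_add]; field_simp
    · rw [hgrid, hq2, h133]; push_cast; rw [pow_add]; field_simp

/-- A grid value `(rne8 K)/2^g`, `|K| < 2^120`, is a `bfloat16` value. [folklore] -/
theorem exists_toRat_eq_rne8_dyadic120 {g : ℕ} (hg : g ≤ 133) (K : ℤ) (hK : K.natAbs < 2 ^ 120) :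
    ∃ y : MiniFloat Format.BFloat16, y.toRat = (rne8 K : ℚ) / 2 ^ g :=
  ⟨_, toRat_roundNE_BFloat16_rne8_wide hg K hK⟩

/-- `rne8` is monotone below `2^120`. [folklore] -/
theorem rne8_mono120 {a b : ℤ} (ha : a.natAbs < 2 ^ 120) (hb : b.natAbs < 2 ^ 120) (hab : a ≤ b) :
    rne8 a ≤ rne8 b := by
  have h1 := toRat_roundNE_BFloat16_rne8_wide (g := 0) (by norm_num) a ha
  have h2 := toRat_roundNE_BFloat16_rne8_wide (g := 0) (by norm_num) b hb
  have hab' : (a : ℚ) / 2 ^ 0 ≤ (b : ℚ) / 2 ^ 0 := by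
    rw [pow_zero, div_one, div_one]; exact_mod_cast hab
  have hm := toRat_roundNE_mono (φ := Format.BFloat16) hab'
  rw [h1, h2, pow_zero, div_one, div_one] at hm
  exact_mod_cast hm

/-! ### One step, gain and deficit in grid units (below `2^120`) -/

/-- `fl_bf16(V/2^g + Q/2^g) = rne8(V + Q)/2^g` below `2^120` grid units. [cell; the bridge] -/
theorem flStep_dyadic120 {g : ℕ} (hg : g ≤ 133) {V Q : ℤ} (h : (V + Q).natAbs < 2 ^ 120) :
    flStep Format.BFloat16 ((V : ℚ) / 2 ^ g) ((Q : ℚ) / 2 ^ g) = (rne8 (V + Q) : ℚ) / 2 ^ g := by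
  unfold flStep
  rw [show (V : ℚ) / 2 ^ g + (Q : ℚ) / 2 ^ g = ((V + Q : ℤ) : ℚ) / 2 ^ g by push_cast; ring]
  exact toRat_roundNE_BFloat16_rne8_wide hg (V + Q) h

/-- The gain in grid units, below `2^120`. [cell] -/
theorem gainOf_dyadic120 {g : ℕ} (hg : g ≤ 133) {V Q : ℤ} (h : (V + Q).natAbs < 2 ^ 120) :
    gainOf Format.BFloat16 ((V : ℚ) / 2 ^ g) ((Q : ℚ) / 2 ^ g)
      = ((rne8 (V + Q) - V - Q : ℤ) : ℚ) / 2 ^ g := by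
  unfold gainOf; rw [flStep_dyadic120 hg h]; push_cast; ring

/-- The deficit in grid units, below `2^120`. [cell] -/
theorem deficitOf_dyadic120 {g : ℕ} (hg : g ≤ 133) {V Q : ℤ} (h : (V + Q).natAbs < 2 ^ 120) :
    deficitOf Format.BFloat16 ((V : ℚ) / 2 ^ g) ((Q : ℚ) / 2 ^ g)
      = (((Q.natAbs : ℤ) - (rne8 (V + Q) - V - Q) : ℤ) : ℚ) / 2 ^ g := by
  unfold deficitOf
  rw [gainOf_dyadic120 hg h, abs_div, abs_of_pos (by positivity : (0 : ℚ) < 2 ^ g), ← Int.cast_abs,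
    ← Int.natCast_natAbs]
  push_cast; ring

/-! ### Products of the E5M2 alphabets are integers on the grids `2^-32` and `2^-25` -/

/-- `qexp(E5M2) = -16`: E5M2·E5M2 products live on the grid `2^-32`. [cite: MicikeviciusEtAl2022, Table 1] -/
theorem E5M2_qexp_add : Format.E5M2.qexp + Format.E5M2.qexp = -32 := by decide

/-- E4M3·E5M2 products live on the grid `2^-25`. [cite: MicikeviciusEtAl2022, Table 1] -/
theorem E4M3_E5M2_qexp_add : Format.E4M3.qexp + Format.E5M2.qexp = -25 := by decide

/-- An E5M2·E5M2 product in grid units: `a · b = (toInt a · toInt b) / 2^32`. [folklore] -/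
theorem toRat_mul_toRat_E5M2 (a b : MiniFloat Format.E5M2) :
    a.toRat * b.toRat = ((a.toInt * b.toInt : ℤ) : ℚ) / 2 ^ 32 := by
  rw [toRat_mul_toRat, E5M2_qexp_add, zpow_neg, div_eq_mul_inv]; norm_cast

/-- An E4M3·E5M2 product in grid units: `a · b = (toInt a · toInt b) / 2^25`. [folklore] -/
theorem toRat_mul_toRat_E4M3_E5M2 (a : MiniFloat Format.E4M3) (b : MiniFloat Format.E5M2) :
    a.toRat * b.toRat = ((a.toInt * b.toInt : ℤ) : ℚ) / 2 ^ 25 := by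
  rw [toRat_mul_toRat, E4M3_E5M2_qexp_add, zpow_neg, div_eq_mul_inv]; norm_cast

end MiniFloat

end Literature.ComputerArithmetic.FloatingPoint
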